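import Literature.Claims.NS.ClayVariants
import Literature.Analysis.FluidPDE.ClassicalNSHorizonPatching
import Literature.Analysis.FluidPDE.TaoLocalisation
import Literature.Analysis.FluidPDE.TaoEnstrophyLocalisation
import HarnessLib

/-!
# Clay (A)/(C) reference — the TIME-HORIZON axis on `ℝ³`: Tao's Conjecture 1.3 («a smooth finite
# energy solution on `[0, T]` for every `T`») is EQUIVALENT to Fefferman's (A) («smooth on
# `ℝ³ × [0, ∞)` with bounded energy»), and finite-horizon blow-up certificates prove (C)

Companion to `Literature/Claims/NS/ClayVariants.lean` (the «wrong problem» reference of the D-0090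
NS-claims map; Δ-axis Δ7 QUANTIFIERS (ν, t), time-horizon row) in the same namespace
`Literature.Claims.NS.ClayVariants`; the whole-space twin of `ClayHorizonBridge.lean` ((B)/(D),
torus patching). Fefferman's (A) asks, for each Schwartz-class divergence-free datum (4), for ONE
pair `p, u ∈ C^∞(ℝ³ × [0,∞))` ((6)) with bounded energy ((7), one constant for all `t ≥ 0`). The
formulation T. Tao adopts from [feff] — Conjecture 1.3 of Anal. PDE 6 (2013): «Let `(u₀, 0, T)` be
a homogeneous Schwartz set of data. Then there exists a smooth finite energy solution
`(u, p, u₀, 0, T)` with the indicated data», for every `0 < T < ∞`, where a smooth finite energy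
solution has `u, p` smooth on the CLOSED slab `[0, T] × ℝ³` and `‖u‖_{L^∞_t L²_x([0,T]×ℝ³)} < ∞`
(Def. 1.1, (6)) — quantifies `∀ T ∃ (u, p)` instead. Many (A)-type claimed proofs conclude in
Tao's form («for every `T > 0` the solution is smooth on `[0, T]`»), and (C)-type texts exhibit
an obstruction or a blow-up on ONE finite horizon. This file makes these phrasings
kernel-equivalent to, resp. sufficient for, the printed Clay statements, so that none of them is
by itself a «wrong problem (Δ7 horizon)» delta:

* `clayR3_solvable_zero_iff_forall_Icc` — for `ν > 0` and a datum with `∇u₀ ∈ L²`: Clay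
  solvability (`clayR3.Solvable ν 0 u₀`: `u, p` smooth on `ℝ³ × [0,∞)`, `f ≡ 0`, bounded energy)
  ⇔ for every `T > 0` a classical solution on `[0, T] × ℝ³` with `u(0) = u₀` and finite energy
  on `[0, T]`; `clayR3_solvable_zero_iff_forall_Ico` — half-open slabs `[0, T)`;
  `…_of_rapidDecay` — the same for Clay data (4) (which are `H¹`, Tao §1 p. 3). The patching is
  `IsClassicalNSSolutionOn.exists_Ici_of_forall_Icc_finiteEnergy` (`ClassicalNSHorizonPatching.lean`):
  uniqueness of smooth finite-energy solutions from `H¹` data, Tao Cor. 11.4 — in the tree the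
  THEOREM `tao_unconditional_uniqueness_velocity_holds` —, and the horizon-uniform energy bound,
  Tao Lemma 8.1 — the THEOREM `tao_finite_energy_smooth_energy_bound_holds`;
* `clayR3_regularityAt_iff_forall_horizon`, `clayR3_regularity_iff_forall_horizon`,
  `clayR3_regularity_iff_forall_horizon_one` — (A) at one `μ > 0`, resp. (A)
  (`clayR3.Regularity`, definitionally the summit statement `NavierStokesRegularity`), ⇔ «every
  smooth divergence-free datum of class (4) has, for every `T > 0`, a smooth finite-energy
  solution on `[0, T] × ℝ³`» (at `μ`, at every `ν > 0`, resp. at `ν = 1`: the last is Tao's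
  Conjecture 1.3 VERBATIM, his `ν` being normalised to `1`, Rem. 1.2 footnote 3);
* `navierStokesBreakdownR3_of_not_solvable_Icc`, `…_of_not_solvable_Ico` — an UNFORCED Clay
  datum at ONE viscosity admitting, for SOME `T > 0`, no smooth finite-energy solution on
  `[0, T]` (resp. `[0, T)`) proves (C) (`NavierStokesBreakdownR3`, via
  `navierStokesBreakdownR3_of_not_solvable`, Δ7 viscosity scaling of `ClayVariants`);
* `eqOn_Ico_of_claySolution` — a Clay-class global solution coincides on `[0, T)` with ANY
  classical finite-energy solution on `[0, T)` from the same datum (Tao Cor. 11.4 on each `[0, t]`);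
* `navierStokesBreakdownR3_of_localBlowupCertificate`,
  `navierStokesBreakdownR3_of_localGradientBlowupCertificate` — **BLOW-UP CERTIFICATES ⇒ (C)**: a
  classical finite-energy solution of the unforced system on `[0, T) × ℝ³` from a smooth
  divergence-free Clay datum (4), whose velocity (resp. velocity GRADIENT) is unbounded on
  `[0, T) × K` for some compact `K ⊆ ℝ³`, proves `NavierStokesBreakdownR3`: a Clay solution would
  coincide with it on `[0, T)` and be continuous (resp. `C¹`) on the compact `[0, T] × K`. The
  whole-space analogue of `ClayPeriodicBlowupCertificate.lean` (there `∫₀ᵀ ‖∇u‖_∞ = ∞` on `𝕋³`);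
  `navierStokesBreakdownR3_of_localVorticityBlowupCertificate` — the same with the VORTICITY
  `curl u` unbounded on `[0, T) × K` (Beale–Kato–Majda form; `|curl v| ≤ κ ‖∇v‖` pointwise,
  tree lemma `norm_curl_le`).

What remains printed-only / NOT covered on this axis (record as the delta when a claim needs it):
(i) smooth solutions on `[0, T] × ℝ³` WITHOUT an energy bound, or from non-`H¹` data, are not
known to be unique (Tao's Cor. 11.4 needs both) — a claim producing only such solutions does not
compose with (A); (ii) a blow-up of a SPATIAL SUP-NORM (`‖u(t)‖_∞ → ∞` or `‖∇u(t)‖_∞ → ∞` with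
the supremum over all of `ℝ³`) is NOT by itself a certificate here — smoothness on
`ℝ³ × [0,∞)` does not bound spatial suprema; localise to a compact `K` first (or use Tao's
quantitative theory, Thm. 5.4/Cor. 4.3, `tao2011_hasBoundedSobolevNormsOn_of_memSobolevX`, a
named fact not discharged in the tree); (iii) FORCED finite-horizon obstructions: Tao's Cor. 11.4
is printed with a force `f`, the tree's theorem is the case `f ≡ 0` — forced (C)-witnesses go
through `navierStokesBreakdownR3_of_not_solvable` on `[0, ∞)` directly; (iv) local existence
itself (Clay PDF p. 2: «(A) … hold[s] if … `[0,∞)` is replaced by a small time interval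
`[0, T)`») is a «wrong problem (Δ6)» when claimed as the result.

## References

* C. L. Fefferman, *Existence and smoothness of the Navier–Stokes equation*, CMI 2006, (A), (C)
  with (4)–(7), p. 2. [FeffermanClay2006]
* T. Tao, *Localisation and compactness properties of the Navier–Stokes global regularity
  problem*, Anal. PDE 6 (2013) 25–107 = arXiv:1108.1165: Def. 1.1 with (6) and footnote 2,
  Rem. 1.2 (footnote 3: `ν = 1`), Conj. 1.3, Lemma 8.1 (arXiv Lemma 44), Cor. 11.4 (arXiv Cor. 71).
  [Tao2013Localisation] [Tao2011]

WHAT THIS IS NOT: not a claim about NS regularity or blow-up; not a claim about any author beyond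
the typed locator.
-/

noncomputable section

open Set MeasureTheory
open scoped ContDiff ENNReal

namespace Literature.Claims.NS.ClayVariants

open Literature.Analysis Literature.Analysis.FluidPDE

/-! ## Clay data (4) are `H¹` -/

section Datum

/-- **A rapidly decaying `C¹` field has `∇u₀ ∈ L²(ℝ³)`** (Fefferman's (4) with one derivative:
«the Schwartz property implies `H¹`», Tao 2013 §1 p. 3; in the tree
`HasRapidSpatialDecay.lintegral_enorm_iteratedFDeriv_sq_lt_top`, measurability from the continuity
of `∇u₀`). The `H¹` hypothesis of Tao's uniqueness theorem Cor. 11.4 for Clay data.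
[cite: Tao2011, §1 Def. 1.1 p. 3 («the Schwartz property implies H¹»)] -/
theorem memLp_fderiv_two_of_rapidDecay
    {u₀ : EuclideanSpace ℝ (Fin 3) → EuclideanSpace ℝ (Fin 3)} (hdec : HasRapidSpatialDecay u₀)
    (hC1 : ContDiff ℝ 1 u₀) : MemLp (fderiv ℝ u₀) 2 volume := by
  have h1 : ∫⁻ x, ‖fderiv ℝ u₀ x‖ₑ ^ 2 < ⊤ := by
    refine lt_of_le_of_lt (le_of_eq (lintegral_congr fun x => ?_))
      (hdec.lintegral_enorm_iteratedFDeriv_sq_lt_top (μ := volume) 1)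
    rw [← ofReal_norm, ← ofReal_norm, norm_iteratedFDeriv_one]
  exact ⟨(hC1.continuous_fderiv one_ne_zero).aestronglyMeasurable,
    eLpNorm_two_lt_top_of_lintegral_enorm_sq_lt_top h1⟩

end Datum

/-! ## Solvability of one Cauchy problem: `[0, ∞)` with bounded energy ⇔ every `[0, T]` -/

section Solvable

variable {ν : ℝ} {u₀ : EuclideanSpace ℝ (Fin 3) → EuclideanSpace ℝ (Fin 3)}

/-- Clay solvability of the unforced whole-space problem, unfolded through the bridge
`isNavierStokesSolution_and_smooth_iff`: a classical solution on `ℝ³ × [0, ∞)` with `u 0 = u₀` and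
bounded energy (7). [cite: FeffermanClay2006, (A) with (6) (7) p. 2] -/
theorem clayR3_solvable_zero_iff_classical :
    clayR3.Solvable ν 0 u₀ ↔
      ∃ (u : ℝ → EuclideanSpace ℝ (Fin 3) → EuclideanSpace ℝ (Fin 3))
        (p : ℝ → EuclideanSpace ℝ (Fin 3) → ℝ),
        IsClassicalNSSolutionOn (Ici 0) ν 0 u p ∧ u 0 = u₀ ∧ HasBoundedEnergy u := by
  constructor
  · rintro ⟨u, p, hu, hp, hns, hadm⟩
    have hcl := isNavierStokesSolution_and_smooth_iff.1 ⟨hns, hu, hp⟩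
    exact ⟨u, p, hcl.1, hcl.2, hadm⟩
  · rintro ⟨u, p, hcl, h0, hE⟩
    have hns := isNavierStokesSolution_and_smooth_iff.2 ⟨hcl, h0⟩
    exact ⟨u, p, hns.2.1, hns.2.2, hns.1, hE⟩

/-- **Clay (A)-solvability ⇔ a smooth finite-energy solution on every closed slab `[0, T]`**
(`ν > 0`, `f ≡ 0`, datum with `∇u₀ ∈ L²`): (⇒) restrict the global solution, the energy bound
restricts; (⇐) patch the slab solutions — any two agree at common times by Tao's uniqueness of
smooth finite-energy solutions from `H¹` data (Cor. 11.4, tree theorem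
`tao_unconditional_uniqueness_velocity_holds`), and the patched solution has bounded energy on
`[0, ∞)` by Tao's horizon-uniform energy inequality (Lemma 8.1, tree theorem
`tao_finite_energy_smooth_energy_bound_holds`) — `IsClassicalNSSolutionOn.exists_Ici_boundedEnergy_iff_forall_Icc`.
Fefferman's class (A) per datum ⇔ Tao's «smooth finite energy solution for every `T`» per datum.
[cite: FeffermanClay2006, (A) with (4) (6) (7) p. 2] [cite: Tao2013Localisation, Def. 1.1 (6), Rem. 1.2, Conj. 1.3, Cor. 11.4, Lemma 8.1] -/
theorem clayR3_solvable_zero_iff_forall_Icc (hν : 0 < ν) (hH1 : MemLp (fderiv ℝ u₀) 2 volume) :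
    clayR3.Solvable ν 0 u₀ ↔
      ∀ T : ℝ, 0 < T →
        ∃ (u : ℝ → EuclideanSpace ℝ (Fin 3) → EuclideanSpace ℝ (Fin 3))
          (p : ℝ → EuclideanSpace ℝ (Fin 3) → ℝ),
          IsClassicalNSSolutionOn (Icc 0 T) ν 0 u p ∧ u 0 = u₀ ∧
            ∃ A : ℝ≥0∞, A < ⊤ ∧ ∀ t ∈ Icc 0 T, ∫⁻ x, ‖u t x‖ₑ ^ 2 ≤ A := by
  rw [clayR3_solvable_zero_iff_classical]
  exact IsClassicalNSSolutionOn.exists_Ici_boundedEnergy_iff_forall_Icc hν hH1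

/-- **The same with half-open slabs `[0, T)`** (finite energy on `[0, T)`).
[cite: FeffermanClay2006, (A) with (4) (6) (7) p. 2] [cite: Tao2013Localisation, Def. 1.1 (6), Conj. 1.3, Cor. 11.4, Lemma 8.1] -/
theorem clayR3_solvable_zero_iff_forall_Ico (hν : 0 < ν) (hH1 : MemLp (fderiv ℝ u₀) 2 volume) :
    clayR3.Solvable ν 0 u₀ ↔
      ∀ T : ℝ, 0 < T →
        ∃ (u : ℝ → EuclideanSpace ℝ (Fin 3) → EuclideanSpace ℝ (Fin 3))
          (p : ℝ → EuclideanSpace ℝ (Fin 3) → ℝ),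
          IsClassicalNSSolutionOn (Ico 0 T) ν 0 u p ∧ u 0 = u₀ ∧
            ∃ A : ℝ≥0∞, A < ⊤ ∧ ∀ t ∈ Ico 0 T, ∫⁻ x, ‖u t x‖ₑ ^ 2 ≤ A := by
  rw [clayR3_solvable_zero_iff_classical]
  exact IsClassicalNSSolutionOn.exists_Ici_boundedEnergy_iff_forall_Ico hν hH1

/-- **Clay data (4)**: for a `C¹` rapidly decaying datum, Clay (A)-solvability ⇔ a smooth
finite-energy solution on `[0, T]` for every `T > 0` (`memLp_fderiv_two_of_rapidDecay`).
[cite: FeffermanClay2006, (A) with (4) (6) (7) p. 2] [cite: Tao2013Localisation, Conj. 1.3, Cor. 11.4, Lemma 8.1] -/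
theorem clayR3_solvable_zero_iff_forall_Icc_of_rapidDecay (hν : 0 < ν) (hu₀ : ContDiff ℝ 1 u₀)
    (hdec : HasRapidSpatialDecay u₀) :
    clayR3.Solvable ν 0 u₀ ↔
      ∀ T : ℝ, 0 < T →
        ∃ (u : ℝ → EuclideanSpace ℝ (Fin 3) → EuclideanSpace ℝ (Fin 3))
          (p : ℝ → EuclideanSpace ℝ (Fin 3) → ℝ),
          IsClassicalNSSolutionOn (Icc 0 T) ν 0 u p ∧ u 0 = u₀ ∧
            ∃ A : ℝ≥0∞, A < ⊤ ∧ ∀ t ∈ Icc 0 T, ∫⁻ x, ‖u t x‖ₑ ^ 2 ≤ A :=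
  clayR3_solvable_zero_iff_forall_Icc hν (memLp_fderiv_two_of_rapidDecay hdec hu₀)

/-- **Clay data (4), half-open slabs.** [cite: FeffermanClay2006, (A) with (4) (6) (7) p. 2] [cite: Tao2013Localisation, Conj. 1.3, Cor. 11.4, Lemma 8.1] -/
theorem clayR3_solvable_zero_iff_forall_Ico_of_rapidDecay (hν : 0 < ν) (hu₀ : ContDiff ℝ 1 u₀)
    (hdec : HasRapidSpatialDecay u₀) :
    clayR3.Solvable ν 0 u₀ ↔
      ∀ T : ℝ, 0 < T →
        ∃ (u : ℝ → EuclideanSpace ℝ (Fin 3) → EuclideanSpace ℝ (Fin 3))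
          (p : ℝ → EuclideanSpace ℝ (Fin 3) → ℝ),
          IsClassicalNSSolutionOn (Ico 0 T) ν 0 u p ∧ u 0 = u₀ ∧
            ∃ A : ℝ≥0∞, A < ⊤ ∧ ∀ t ∈ Ico 0 T, ∫⁻ x, ‖u t x‖ₑ ^ 2 ≤ A :=
  clayR3_solvable_zero_iff_forall_Ico hν (memLp_fderiv_two_of_rapidDecay hdec hu₀)

end Solvable

/-! ## (A) in finite-horizon form: Tao's Conjecture 1.3 -/

section Statements

/-- **(A) at one viscosity `μ > 0` in finite-horizon form**: `clayR3.RegularityAt μ` ⇔ every smooth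
divergence-free datum of class (4) has, for every `T > 0`, a classical solution of the unforced
system on `[0, T] × ℝ³` (jointly smooth on the closed slab) with that datum and finite energy
`sup_{[0,T]} ∫ |u|² < ∞` (pointwise-in-`t` form of Tao's (6), equivalent for smooth `u` by
Fatou). [cite: FeffermanClay2006, (A) with (4) (6) (7) p. 2] [cite: Tao2013Localisation, Def. 1.1 (6), Conj. 1.3] -/
theorem clayR3_regularityAt_iff_forall_horizon {μ : ℝ} (hμ : 0 < μ) :
    clayR3.RegularityAt μ ↔
      ∀ u₀ : EuclideanSpace ℝ (Fin 3) → EuclideanSpace ℝ (Fin 3), ContDiff ℝ ∞ u₀ →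
        NSWave0.IsDivFree u₀ → HasRapidSpatialDecay u₀ →
          ∀ T : ℝ, 0 < T →
            ∃ (u : ℝ → EuclideanSpace ℝ (Fin 3) → EuclideanSpace ℝ (Fin 3))
              (p : ℝ → EuclideanSpace ℝ (Fin 3) → ℝ),
              IsClassicalNSSolutionOn (Icc 0 T) μ 0 u p ∧ u 0 = u₀ ∧
                ∃ A : ℝ≥0∞, A < ⊤ ∧ ∀ t ∈ Icc 0 T, ∫⁻ x, ‖u t x‖ₑ ^ 2 ≤ A :=
  forall_congr' fun u₀ => forall_congr' fun hu₀ => forall_congr' fun _ => forall_congr' fun hdec =>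
    clayR3_solvable_zero_iff_forall_Icc_of_rapidDecay hμ (hu₀.of_le (by norm_cast)) hdec

/-- **(A) in finite-horizon form, all viscosities**: `clayR3.Regularity` (definitionally the summit
statement `NavierStokesRegularity`, Clay (A)) ⇔ for every `ν > 0`, every smooth divergence-free
datum of class (4) has for every `T > 0` a smooth finite-energy solution on `[0, T] × ℝ³`.
[cite: FeffermanClay2006, (A) with (4) (6) (7) p. 2] [cite: Tao2013Localisation, Def. 1.1 (6), Conj. 1.3] -/
theorem clayR3_regularity_iff_forall_horizon :
    clayR3.Regularity ↔
      ∀ ν : ℝ, 0 < ν →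
        ∀ u₀ : EuclideanSpace ℝ (Fin 3) → EuclideanSpace ℝ (Fin 3), ContDiff ℝ ∞ u₀ →
          NSWave0.IsDivFree u₀ → HasRapidSpatialDecay u₀ →
            ∀ T : ℝ, 0 < T →
              ∃ (u : ℝ → EuclideanSpace ℝ (Fin 3) → EuclideanSpace ℝ (Fin 3))
                (p : ℝ → EuclideanSpace ℝ (Fin 3) → ℝ),
                IsClassicalNSSolutionOn (Icc 0 T) ν 0 u p ∧ u 0 = u₀ ∧
                  ∃ A : ℝ≥0∞, A < ⊤ ∧ ∀ t ∈ Icc 0 T, ∫⁻ x, ‖u t x‖ₑ ^ 2 ≤ A :=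
  forall₂_congr fun _ hν => clayR3_regularityAt_iff_forall_horizon hν

/-- **Clay (A) ⇔ Tao's Conjecture 1.3, verbatim** («Let `(u₀, 0, T)` be a homogeneous Schwartz set
of data. Then there exists a smooth finite energy solution `(u, p, u₀, 0, T)` with the indicated
data», for all `0 < T < ∞`, viscosity normalised to `ν = 1`): `clayR3.Regularity` ⇔ every smooth
divergence-free datum of class (4) has, at `ν = 1` and for every `T > 0`, a classical finite-energy
solution on `[0, T] × ℝ³` — (A) at `ν = 1` is (A) (`clayR3_regularityAt_iff`, scaling) and the
horizon bridge. Neither the single viscosity nor the finite horizons is a «wrong problem» delta.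
[cite: Tao2013Localisation, Conj. 1.3 with Def. 1.1 (6) and Rem. 1.2 footnote 3] [cite: FeffermanClay2006, (A) p. 2] -/
theorem clayR3_regularity_iff_forall_horizon_one :
    clayR3.Regularity ↔
      ∀ u₀ : EuclideanSpace ℝ (Fin 3) → EuclideanSpace ℝ (Fin 3), ContDiff ℝ ∞ u₀ →
        NSWave0.IsDivFree u₀ → HasRapidSpatialDecay u₀ →
          ∀ T : ℝ, 0 < T →
            ∃ (u : ℝ → EuclideanSpace ℝ (Fin 3) → EuclideanSpace ℝ (Fin 3))
              (p : ℝ → EuclideanSpace ℝ (Fin 3) → ℝ),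
              IsClassicalNSSolutionOn (Icc 0 T) 1 0 u p ∧ u 0 = u₀ ∧
                ∃ A : ℝ≥0∞, A < ⊤ ∧ ∀ t ∈ Icc 0 T, ∫⁻ x, ‖u t x‖ₑ ^ 2 ≤ A := by
  rw [← clayR3_regularityAt_iff one_pos]
  exact clayR3_regularityAt_iff_forall_horizon one_pos

/-- **An UNFORCED finite-horizon obstruction at ONE viscosity proves (C)**: if `μ > 0` and some
smooth divergence-free datum of class (4) admits, for some `T > 0`, NO classical solution of the
unforced system on `[0, T] × ℝ³` with that datum and finite energy on `[0, T]`, then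
`NavierStokesBreakdownR3` (restriction of a would-be Clay solution, then the Δ7 viscosity scaling
`navierStokesBreakdownR3_of_not_solvable`). [cite: FeffermanClay2006, (C) p. 2] [cite: Tao2013Localisation, Rem. 1.2 footnote 3] -/
theorem navierStokesBreakdownR3_of_not_solvable_Icc {μ : ℝ} (hμ : 0 < μ)
    {u₀ : EuclideanSpace ℝ (Fin 3) → EuclideanSpace ℝ (Fin 3)} (hu₀ : ContDiff ℝ ∞ u₀)
    (hdiv : NSWave0.IsDivFree u₀) (hdec : HasRapidSpatialDecay u₀) {T : ℝ} (hT : 0 < T)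
    (hno : ¬ ∃ (u : ℝ → EuclideanSpace ℝ (Fin 3) → EuclideanSpace ℝ (Fin 3))
        (p : ℝ → EuclideanSpace ℝ (Fin 3) → ℝ),
        IsClassicalNSSolutionOn (Icc 0 T) μ 0 u p ∧ u 0 = u₀ ∧
          ∃ A : ℝ≥0∞, A < ⊤ ∧ ∀ t ∈ Icc 0 T, ∫⁻ x, ‖u t x‖ₑ ^ 2 ≤ A) :
    Summit.NavierStokesRegularity.NavierStokesRegularity.NavierStokesBreakdownR3 :=
  navierStokesBreakdownR3_of_not_solvable hμ hu₀ hdiv hdec isSmoothOnHalfSpace_zero clayR3_force_zero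
    fun hsol => hno (((clayR3_solvable_zero_iff_forall_Icc_of_rapidDecay hμ
      (hu₀.of_le (by norm_cast)) hdec).mp hsol) T hT)

/-- The same with the half-open slab `[0, T)`. [cite: FeffermanClay2006, (C) p. 2] [cite: Tao2013Localisation, Rem. 1.2 footnote 3] -/
theorem navierStokesBreakdownR3_of_not_solvable_Ico {μ : ℝ} (hμ : 0 < μ)
    {u₀ : EuclideanSpace ℝ (Fin 3) → EuclideanSpace ℝ (Fin 3)} (hu₀ : ContDiff ℝ ∞ u₀)
    (hdiv : NSWave0.IsDivFree u₀) (hdec : HasRapidSpatialDecay u₀) {T : ℝ} (hT : 0 < T)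
    (hno : ¬ ∃ (u : ℝ → EuclideanSpace ℝ (Fin 3) → EuclideanSpace ℝ (Fin 3))
        (p : ℝ → EuclideanSpace ℝ (Fin 3) → ℝ),
        IsClassicalNSSolutionOn (Ico 0 T) μ 0 u p ∧ u 0 = u₀ ∧
          ∃ A : ℝ≥0∞, A < ⊤ ∧ ∀ t ∈ Ico 0 T, ∫⁻ x, ‖u t x‖ₑ ^ 2 ≤ A) :
    Summit.NavierStokesRegularity.NavierStokesRegularity.NavierStokesBreakdownR3 :=
  navierStokesBreakdownR3_of_not_solvable hμ hu₀ hdiv hdec isSmoothOnHalfSpace_zero clayR3_force_zero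
    fun hsol => hno (((clayR3_solvable_zero_iff_forall_Ico_of_rapidDecay hμ
      (hu₀.of_le (by norm_cast)) hdec).mp hsol) T hT)

end Statements

/-! ## Blow-up certificates on a finite horizon prove (C) -/

section Certificate

variable {μ T : ℝ} {u₀ : EuclideanSpace ℝ (Fin 3) → EuclideanSpace ℝ (Fin 3)}
  {u : ℝ → EuclideanSpace ℝ (Fin 3) → EuclideanSpace ℝ (Fin 3)}
  {p : ℝ → EuclideanSpace ℝ (Fin 3) → ℝ}

/-- **A Clay-class solution coincides on `[0, T)` with any finite-energy classical solution from the
same datum.** Let `μ > 0`, let `(w, q)` be a classical solution on `ℝ³ × [0, ∞)` with bounded energy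
and `w 0 = u₀`, `∇u₀ ∈ L²`, and let `(u, p)` be a classical solution of the same (unforced) system
on `[0, T) × ℝ³` with `u 0 = u₀` and finite energy on `[0, T)`. Then `w t = u t` for `0 ≤ t < T`:
both restrict to smooth finite-energy solutions on the closed slab `[0, (t+T)/2]`, where Tao's
Cor. 11.4 applies (`IsClassicalNSSolutionOn.eq_of_finiteEnergy`). [cite: Tao2011, Cor. 11.4 (arXiv Cor. 71)] -/
theorem eqOn_Ico_of_claySolution (hμ : 0 < μ) (hH1 : MemLp (fderiv ℝ u₀) 2 volume)
    {w : ℝ → EuclideanSpace ℝ (Fin 3) → EuclideanSpace ℝ (Fin 3)}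
    {q : ℝ → EuclideanSpace ℝ (Fin 3) → ℝ}
    (hw : IsClassicalNSSolutionOn (Ici 0) μ 0 w q) (hw0 : w 0 = u₀) (hwE : HasBoundedEnergy w)
    (hcl : IsClassicalNSSolutionOn (Ico 0 T) μ 0 u p) (hu0 : u 0 = u₀)
    (hE : ∃ A : ℝ≥0∞, A < ⊤ ∧ ∀ t ∈ Ico 0 T, ∫⁻ x, ‖u t x‖ₑ ^ 2 ≤ A) :
    ∀ t ∈ Ico 0 T, w t = u t := by
  intro t ht
  -- a closed slab `[0, s]` with `t ≤ s < T`, `0 < s`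
  set s : ℝ := (t + T) / 2 with hs
  have hs0 : 0 < s := by rw [hs]; linarith [ht.1, ht.2]
  have hts : t ≤ s := by rw [hs]; linarith [ht.2]
  have hsT : s < T := by rw [hs]; linarith [ht.2]
  have hw' : IsClassicalNSSolutionOn (Icc 0 s) μ 0 w q :=
    hw.mono Icc_subset_Ici_self (uniqueDiffOn_Icc hs0)
  have hu' : IsClassicalNSSolutionOn (Icc 0 s) μ 0 u p :=
    hcl.mono (Icc_subset_Ico_right hsT) (uniqueDiffOn_Icc hs0)
  have hwE' : ∃ A : ℝ≥0∞, A < ⊤ ∧ ∀ r ∈ Icc 0 s, ∫⁻ x, ‖w r x‖ₑ ^ 2 ≤ A := by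
    obtain ⟨C, hC, hb⟩ := hwE
    exact ⟨C, hC, fun r hr => hb r hr.1⟩
  have huE' : ∃ A : ℝ≥0∞, A < ⊤ ∧ ∀ r ∈ Icc 0 s, ∫⁻ x, ‖u r x‖ₑ ^ 2 ≤ A := by
    obtain ⟨A, hA, hb⟩ := hE
    exact ⟨A, hA, fun r hr => hb r ⟨hr.1, hr.2.trans_lt hsT⟩⟩
  exact hw'.eq_of_finiteEnergy hμ hH1 hu' hw0 hu0 hwE' huE' ⟨ht.1, hts⟩ hts

/-- **LOCAL VELOCITY BLOW-UP on a finite horizon proves (C).** Let `μ > 0`, `u₀` a smooth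
divergence-free datum of class (4), and `(u, p)` a classical solution of the unforced system on
`[0, T) × ℝ³` with `u 0 = u₀`, finite energy on `[0, T)`, and velocity UNBOUNDED on
`[0, T) × K` for some compact `K ⊆ ℝ³` (`∀ M, ∃ t ∈ [0,T), ∃ x ∈ K, M < |u(t,x)|`). Then
`NavierStokesBreakdownR3`: a Clay solution `(w, q)` from `u₀` would equal `u` on `[0, T)`
(`eqOn_Ico_of_claySolution`) while being continuous, hence bounded, on the compact `[0, T] × K`; so
`u₀` has no Clay solution at `μ`, and `navierStokesBreakdownR3_of_not_solvable` concludes.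
[cite: FeffermanClay2006, (C) with (4)–(7) p. 2] [cite: Tao2011, Cor. 11.4 (arXiv Cor. 71)] -/
theorem navierStokesBreakdownR3_of_localBlowupCertificate (hμ : 0 < μ) (hu₀ : ContDiff ℝ ∞ u₀)
    (hdiv : NSWave0.IsDivFree u₀) (hdec : HasRapidSpatialDecay u₀)
    (hcl : IsClassicalNSSolutionOn (Ico 0 T) μ 0 u p) (hu0 : u 0 = u₀)
    (hE : ∃ A : ℝ≥0∞, A < ⊤ ∧ ∀ t ∈ Ico 0 T, ∫⁻ x, ‖u t x‖ₑ ^ 2 ≤ A)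
    {K : Set (EuclideanSpace ℝ (Fin 3))} (hK : IsCompact K)
    (hblow : ∀ M : ℝ, ∃ t ∈ Ico 0 T, ∃ x ∈ K, M < ‖u t x‖) :
    Summit.NavierStokesRegularity.NavierStokesRegularity.NavierStokesBreakdownR3 := by
  refine navierStokesBreakdownR3_of_not_solvable hμ hu₀ hdiv hdec isSmoothOnHalfSpace_zero
    clayR3_force_zero fun hsol => ?_
  obtain ⟨w, q, hw, hw0, hwE⟩ := clayR3_solvable_zero_iff_classical.mp hsol
  have heq : ∀ t ∈ Ico 0 T, w t = u t :=
    eqOn_Ico_of_claySolution hμ (memLp_fderiv_two_of_rapidDecay hdec (hu₀.of_le (by norm_cast)))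
      hw hw0 hwE hcl hu0 hE
  -- `w` is continuous on the compact `[0, T] × K`, hence bounded there
  have hcont : ContinuousOn (Function.uncurry w) (Icc 0 T ×ˢ K) :=
    hw.smooth_velocity.continuousOn.mono (prod_mono Icc_subset_Ici_self (subset_univ K))
  obtain ⟨C, hC⟩ := (isCompact_Icc.prod hK).exists_bound_of_continuousOn hcont
  obtain ⟨t, ht, x, hx, hM⟩ := hblow C
  have h1 : ‖u t x‖ ≤ C := by
    rw [← heq t ht]
    exact hC (t, x) ⟨Ico_subset_Icc_self ht, hx⟩
  exact absurd hM (not_lt.2 h1)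

/-- **The velocity gradient of a classical solution on `ℝ³ × [0, ∞)` is jointly continuous**: for
`w` jointly `C^∞` on `[0, ∞) × ℝ³`, `(t, x) ↦ ∇ₓw(t, x) = D(uncurry w)(t, x) ∘ (0, ·)` is continuous
on `[0, ∞) × ℝ³` (Mathlib `ContDiffOn.continuousOn_fderivWithin`, chain rule through the slice
map `x ↦ (t, x)`). [cite: FeffermanClay2006, (6) p. 2] -/
theorem continuousOn_fderiv_slice_of_isSmoothSpaceTimeOn
    {w : ℝ → EuclideanSpace ℝ (Fin 3) → EuclideanSpace ℝ (Fin 3)}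
    (hw : IsSmoothSpaceTimeOn (Ici 0) w) :
    ContinuousOn (fun z : ℝ × EuclideanSpace ℝ (Fin 3) => fderiv ℝ (w z.1) z.2)
      (Ici (0 : ℝ) ×ˢ univ) := by
  set Sset : Set (ℝ × EuclideanSpace ℝ (Fin 3)) := Ici (0 : ℝ) ×ˢ univ with hSset
  have hU : UniqueDiffOn ℝ Sset := (uniqueDiffOn_Ici 0).prod uniqueDiffOn_univ
  have hW : ContDiffOn ℝ ∞ (Function.uncurry w) Sset := hw
  have hD : ContinuousOn (fun z => fderivWithin ℝ (Function.uncurry w) Sset z) Sset :=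
    hW.continuousOn_fderivWithin hU (by simp)
  have hcomp : ContinuousOn
      (fun z => (fderivWithin ℝ (Function.uncurry w) Sset z).comp
        (ContinuousLinearMap.inr ℝ ℝ (EuclideanSpace ℝ (Fin 3)))) Sset :=
    hD.clm_comp continuousOn_const
  refine hcomp.congr fun z hz => ?_
  obtain ⟨t, x⟩ := z
  have ht : t ∈ Ici (0 : ℝ) := (mem_prod.1 hz).1
  -- chain rule through the slice map `y ↦ (t, y)`
  have hdiff : DifferentiableWithinAt ℝ (Function.uncurry w) Sset (t, x) :=
    (hW (t, x) hz).differentiableWithinAt (by simp)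
  have hslice : HasFDerivWithinAt (fun y : EuclideanSpace ℝ (Fin 3) => (t, y))
      (ContinuousLinearMap.inr ℝ ℝ (EuclideanSpace ℝ (Fin 3))) univ x :=
    (hasFDerivAt_prodMk_right t x).hasFDerivWithinAt
  have hmaps : MapsTo (fun y : EuclideanSpace ℝ (Fin 3) => (t, y)) univ Sset :=
    fun y _ => ⟨ht, mem_univ _⟩
  have hchain := hdiff.hasFDerivWithinAt.comp x hslice hmaps
  have hfun : (Function.uncurry w ∘ fun y : EuclideanSpace ℝ (Fin 3) => (t, y)) = w t := rfl
  rw [hfun] at hchain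
  exact (hchain.hasFDerivAt_of_univ).fderiv

/-- **LOCAL GRADIENT BLOW-UP on a finite horizon proves (C)** (the whole-space, Beale–Kato–Majda-type
certificate). As `navierStokesBreakdownR3_of_localBlowupCertificate`, with the velocity GRADIENT
unbounded on `[0, T) × K`, `K` compact (`∀ M, ∃ t ∈ [0,T), ∃ x ∈ K, M < ‖∇u(t,x)‖`): a Clay
solution from `u₀` would equal `u` on `[0, T)`, and its gradient is continuous
(`continuousOn_fderiv_slice_of_isSmoothSpaceTimeOn`), hence bounded, on the compact `[0, T] × K`.
A spatial sup-norm blow-up must first be localised to a compact `K` to use this.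
[cite: FeffermanClay2006, (C) with (4)–(7) p. 2] [cite: Tao2011, Cor. 11.4 (arXiv Cor. 71)] -/
theorem navierStokesBreakdownR3_of_localGradientBlowupCertificate (hμ : 0 < μ)
    (hu₀ : ContDiff ℝ ∞ u₀) (hdiv : NSWave0.IsDivFree u₀) (hdec : HasRapidSpatialDecay u₀)
    (hcl : IsClassicalNSSolutionOn (Ico 0 T) μ 0 u p) (hu0 : u 0 = u₀)
    (hE : ∃ A : ℝ≥0∞, A < ⊤ ∧ ∀ t ∈ Ico 0 T, ∫⁻ x, ‖u t x‖ₑ ^ 2 ≤ A)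
    {K : Set (EuclideanSpace ℝ (Fin 3))} (hK : IsCompact K)
    (hblow : ∀ M : ℝ, ∃ t ∈ Ico 0 T, ∃ x ∈ K, M < ‖fderiv ℝ (u t) x‖) :
    Summit.NavierStokesRegularity.NavierStokesRegularity.NavierStokesBreakdownR3 := by
  refine navierStokesBreakdownR3_of_not_solvable hμ hu₀ hdiv hdec isSmoothOnHalfSpace_zero
    clayR3_force_zero fun hsol => ?_
  obtain ⟨w, q, hw, hw0, hwE⟩ := clayR3_solvable_zero_iff_classical.mp hsol
  have heq : ∀ t ∈ Ico 0 T, w t = u t :=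
    eqOn_Ico_of_claySolution hμ (memLp_fderiv_two_of_rapidDecay hdec (hu₀.of_le (by norm_cast)))
      hw hw0 hwE hcl hu0 hE
  have hcont : ContinuousOn (fun z : ℝ × EuclideanSpace ℝ (Fin 3) => fderiv ℝ (w z.1) z.2)
      (Icc 0 T ×ˢ K) :=
    (continuousOn_fderiv_slice_of_isSmoothSpaceTimeOn hw.smooth_velocity).mono
      (prod_mono Icc_subset_Ici_self (subset_univ K))
  obtain ⟨C, hC⟩ := (isCompact_Icc.prod hK).exists_bound_of_continuousOn hcont
  obtain ⟨t, ht, x, hx, hM⟩ := hblow C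
  have h1 : ‖fderiv ℝ (u t) x‖ ≤ C := by
    rw [← heq t ht]
    exact hC (t, x) ⟨Ico_subset_Icc_self ht, hx⟩
  exact absurd hM (not_lt.2 h1)

/-- **LOCAL VORTICITY BLOW-UP on a finite horizon proves (C)** (Beale–Kato–Majda form of the
certificate). As `navierStokesBreakdownR3_of_localGradientBlowupCertificate`, with the vorticity
`curl u` unbounded on `[0, T) × K`, `K` compact (`∀ M, ∃ t ∈ [0,T), ∃ x ∈ K, M < |curl u(t,x)|`):
pointwise `|curl v(x)| ≤ κ ‖∇v(x)‖` with the absolute constant `κ = ‖curlCLM‖` (tree lemma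
`norm_curl_le`), so the gradient is unbounded on `[0, T) × K` as well. A spatial sup-norm statement
`‖ω(t)‖_∞ → ∞` must first be localised to a compact `K` to use this.
[cite: FeffermanClay2006, (C) with (4)–(7) p. 2] [cite: BealeKatoMajda1984, §1] -/
theorem navierStokesBreakdownR3_of_localVorticityBlowupCertificate (hμ : 0 < μ)
    (hu₀ : ContDiff ℝ ∞ u₀) (hdiv : NSWave0.IsDivFree u₀) (hdec : HasRapidSpatialDecay u₀)
    (hcl : IsClassicalNSSolutionOn (Ico 0 T) μ 0 u p) (hu0 : u 0 = u₀)
    (hE : ∃ A : ℝ≥0∞, A < ⊤ ∧ ∀ t ∈ Ico 0 T, ∫⁻ x, ‖u t x‖ₑ ^ 2 ≤ A)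
    {K : Set (EuclideanSpace ℝ (Fin 3))} (hK : IsCompact K)
    (hblow : ∀ M : ℝ, ∃ t ∈ Ico 0 T, ∃ x ∈ K, M < ‖curl (u t) x‖) :
    Summit.NavierStokesRegularity.NavierStokesRegularity.NavierStokesBreakdownR3 := by
  refine navierStokesBreakdownR3_of_localGradientBlowupCertificate hμ hu₀ hdiv hdec hcl hu0 hE hK
    fun M => ?_
  -- `κ · max M 0 < |curl u| ≤ κ ‖∇u‖` forces `max M 0 < ‖∇u‖`
  obtain ⟨t, ht, x, hx, hM⟩ := hblow (‖curlCLM‖ * max M 0)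
  refine ⟨t, ht, x, hx, (le_max_left M 0).trans_lt ?_⟩
  exact lt_of_mul_lt_mul_left (hM.trans_le (norm_curl_le (u t) x)) (ContinuousLinearMap.opNorm_nonneg curlCLM)

end Certificate

end Literature.Claims.NS.ClayVariants

end

-- WHAT THIS IS NOT: not a claim about NS regularity or blow-up; not a claim about any author beyond the typed locator.
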